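import Literature.Analysis.FluidPDE.RadialMeanIdentity
import Literature.Analysis.FluidPDE.AsymBurgersLinearizedEvenInvertibility
import HarnessLib

/-!
# Maekawa's even-sector inverse bound: proof

Discharge of `Literature.Analysis.FluidPDE.Maekawa2009_evenSectorInverseBound` (Maekawa 2009,
M3AS 19, §4, Lemma 4.1 (4.1); Gallay–Maekawa 2016, §4.1 (4.9)): for `λ ∈ [0,1)` there are `Θ, C`
with `‖w‖_{X_λ} ≤ C ‖(L + λM − αΛ)w‖_{X_λ}` for all `|α| ≥ Θ` and all even, mass-zero
`w ∈ C²_c(ℝ²)`.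

The printed proof (skew-symmetrizer, Fredholm alternative, compactness) is replaced by the
quantitative argument assembled from the support files (`a = 1 − λ`, `p = e^{a|x|²/4}`,
`N_w = ∫ p w²`, `N_f = ∫ p f²`):

* `AsymBurgersUniformEnergy`: `∫ p(|∇w|² + |x|²w²) ≤ C_E (N_w + N_f)`;
* `AsymBurgersAngularSmallness`: `|α| ∫ pχΩ (∂_θu)² ≤ C_N (N_w + N_f)`, `u = w + Φψ`;
* `AsymBurgersEvenPositivity`: `∫ pχΩ (∂_θw)² ≤ K ∫ pχΩ (∂_θu)²` (even, mass zero);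
* `PlanarCircleWirtinger`: `∫ ρ (w − m̄)² ≤ ∫ ρ (∂_θw)²` (Wirtinger on circles), Pythagoras;
* `RadialMeanIdentity` + `RadialMeanHardyBound`: `∫_0^R p r M₀² ≤ (1716/a²)(N_F̄ + λ²N_𝒜)`.

Splitting `N_w` into the deviation from circular means (small for `|α|` large, by the three
angular files, up to a far-field term controlled by the energy bound) and the circular mean
(controlled by the radial files in terms of `N_f` and the deviation) closes the estimate with
`C² = 1 + 3432/a²`.

## References

* Y. Maekawa, *Existence of asymmetric Burgers vortices and their asymptotic behavior at large
  circulations*, Math. Models Methods Appl. Sci. 19 (2009) 669–705, §4 Lemma 4.1. [Maekawa2009b]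
* Th. Gallay, Y. Maekawa, *Existence and stability of viscous vortices*, Handbook of Mathematical
  Analysis in Mechanics of Viscous Fluids (2016), §4.1 (4.9). [GallayMaekawa2016]
-/

noncomputable section

open Set Function Filter MeasureTheory Metric Real
open scoped InnerProductSpace RealInnerProductSpace Topology Laplacian

namespace Literature.Analysis.FluidPDE

/-! ### Scalar tools -/

/-- `1/(1+t) ≤ φ(t)` for `t ≥ 0` (private copy of `KerWeightBounds`' lemma). [folklore] -/
private theorem one_div_one_add_le_burgersPhi'' {t : ℝ} (ht : 0 ≤ t) : 1 / (1 + t) ≤ burgersPhi t := by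
  rcases ht.eq_or_lt with rfl | ht'
  · simp
  · rw [burgersPhi_of_ne_zero ht'.ne', div_le_div_iff₀ (by linarith) ht']
    have h1 : 1 + t ≤ Real.exp t := by linarith [Real.add_one_le_exp t]
    have h2 : Real.exp (-t) * Real.exp t = 1 := by rw [← Real.exp_add]; simp
    nlinarith [Real.exp_pos (-t), Real.exp_pos t]

/-- **The weight split.** For `R₁ > 0` and every `x`,
`p ≤ M₁ · (pχΩ) + R₁⁻² · p|x|²` with `M₁ = 8π(1+R₁²)(1+R₁²/4)`: near the origin `χΩ ≥ 1/M₁`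
(`Ω = (8π)⁻¹φ(|x|²/4)`, `φ(s) ≥ 1/(1+s)`), far away `1 ≤ |x|²/R₁²`. [folklore] -/
theorem gaussWeight_le_split (lam : ℝ) {R₁ : ℝ} (hR₁ : 0 < R₁) (x : EuclideanSpace ℝ (Fin 2)) :
    Real.exp ((1 - lam) / 4 * ‖x‖ ^ 2) ≤ 8 * π * (1 + R₁ ^ 2) * (1 + R₁ ^ 2 / 4) * ((Real.exp ((1 - lam) / 4 * ‖x‖ ^ 2) * (1 + ‖x‖ ^ 2)⁻¹) * (gaussVortexProfile x / (2 * kerWeight ‖x‖))) + (R₁ ^ 2)⁻¹ * (Real.exp ((1 - lam) / 4 * ‖x‖ ^ 2) * ‖x‖ ^ 2) := by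
  have hp : 0 < Real.exp ((1 - lam) / 4 * ‖x‖ ^ 2) := Real.exp_pos _
  have hΩ := gaussVortexProfile_div_two_mul_kerWeight_le x
  have h0 : 0 ≤ ((Real.exp ((1 - lam) / 4 * ‖x‖ ^ 2) * (1 + ‖x‖ ^ 2)⁻¹) * (gaussVortexProfile x / (2 * kerWeight ‖x‖))) := by
    have := hΩ.1.le
    positivity
  rcases le_or_gt ‖x‖ R₁ with hx | hx
  · -- near: `1 ≤ M₁ χ Ω`
    have hφ : 1 / (1 + ‖x‖ ^ 2 / 4) ≤ burgersPhi (‖x‖ ^ 2 / 4) := one_div_one_add_le_burgersPhi'' (by positivity)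
    have hχ : (1 + R₁ ^ 2)⁻¹ ≤ (1 + ‖x‖ ^ 2)⁻¹ := by
      rw [inv_le_inv₀ (by positivity) (by positivity)]; nlinarith [norm_nonneg x]
    have hφ' : 1 / (1 + R₁ ^ 2 / 4) ≤ burgersPhi (‖x‖ ^ 2 / 4) := by
      refine le_trans ?_ hφ
      rw [div_le_div_iff₀ (by positivity) (by positivity)]; nlinarith [norm_nonneg x]
    have hkey : 1 ≤ 8 * π * (1 + R₁ ^ 2) * (1 + R₁ ^ 2 / 4) * ((1 + ‖x‖ ^ 2)⁻¹ * (gaussVortexProfile x / (2 * kerWeight ‖x‖))) := by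
      rw [gaussVortexProfile_div_two_mul_kerWeight]
      have h1 : (1 + R₁ ^ 2)⁻¹ * (1 / (1 + R₁ ^ 2 / 4)) ≤ (1 + ‖x‖ ^ 2)⁻¹ * burgersPhi (‖x‖ ^ 2 / 4) :=
        mul_le_mul hχ hφ' (by positivity) (by positivity)
      have h2 : 8 * π * (1 + R₁ ^ 2) * (1 + R₁ ^ 2 / 4) * ((1 + ‖x‖ ^ 2)⁻¹ * ((8 * π)⁻¹ * burgersPhi (‖x‖ ^ 2 / 4))) =
          ((1 + R₁ ^ 2) * (1 + R₁ ^ 2 / 4)) * ((1 + ‖x‖ ^ 2)⁻¹ * burgersPhi (‖x‖ ^ 2 / 4)) := by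
        field_simp
      have h3 : ((1 + R₁ ^ 2) * (1 + R₁ ^ 2 / 4)) * ((1 + R₁ ^ 2)⁻¹ * (1 / (1 + R₁ ^ 2 / 4))) = 1 := by
        field_simp
      rw [h2]
      calc (1:ℝ) = ((1 + R₁ ^ 2) * (1 + R₁ ^ 2 / 4)) * ((1 + R₁ ^ 2)⁻¹ * (1 / (1 + R₁ ^ 2 / 4))) := h3.symm
        _ ≤ _ := mul_le_mul_of_nonneg_left h1 (by positivity)
    have h4 : Real.exp ((1 - lam) / 4 * ‖x‖ ^ 2) ≤ 8 * π * (1 + R₁ ^ 2) * (1 + R₁ ^ 2 / 4) * ((Real.exp ((1 - lam) / 4 * ‖x‖ ^ 2) * (1 + ‖x‖ ^ 2)⁻¹) * (gaussVortexProfile x / (2 * kerWeight ‖x‖))) := by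
      have := mul_le_mul_of_nonneg_left hkey hp.le
      rw [mul_one] at this
      refine this.trans (le_of_eq ?_)
      ring
    have h5 : 0 ≤ (R₁ ^ 2)⁻¹ * (Real.exp ((1 - lam) / 4 * ‖x‖ ^ 2) * ‖x‖ ^ 2) := by positivity
    linarith
  · -- far: `1 ≤ |x|²/R₁²`
    have hkey : 1 ≤ (R₁ ^ 2)⁻¹ * ‖x‖ ^ 2 := by
      rw [inv_mul_eq_div, le_div_iff₀ (by positivity)]; nlinarith [norm_nonneg x]
    have h4 : Real.exp ((1 - lam) / 4 * ‖x‖ ^ 2) ≤ (R₁ ^ 2)⁻¹ * (Real.exp ((1 - lam) / 4 * ‖x‖ ^ 2) * ‖x‖ ^ 2) := by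
      have := mul_le_mul_of_nonneg_left hkey hp.le
      rw [mul_one] at this
      refine this.trans (le_of_eq ?_)
      ring
    have h5 : 0 ≤ 8 * π * (1 + R₁ ^ 2) * (1 + R₁ ^ 2 / 4) * ((Real.exp ((1 - lam) / 4 * ‖x‖ ^ 2) * (1 + ‖x‖ ^ 2)⁻¹) * (gaussVortexProfile x / (2 * kerWeight ‖x‖))) := by positivity
    linarith

/-- A continuous radial function vanishing beyond `R ≥ 0` is integrable on `(0, ∞)`. [folklore] -/
theorem integrableOn_Ioi_of_vanishing {h : ℝ → ℝ} (hh : Continuous h) {R : ℝ} (hR : 0 ≤ R)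
    (hz : ∀ r, R < r → h r = 0) : IntegrableOn h (Ioi 0) := by
  have hI : IntegrableOn h (Ioi R) :=
    (integrableOn_zero (s := Ioi R)).congr_fun (fun r hr => (hz r hr).symm) measurableSet_Ioi
  rw [← Ioc_union_Ioi_eq_Ioi hR]
  exact (hh.integrableOn_Icc.mono_set Ioc_subset_Icc_self).union hI

/-- Compact support from vanishing outside a ball. [folklore] -/
theorem hasCompactSupport_of_norm_le {f : EuclideanSpace ℝ (Fin 2) → ℝ} {R : ℝ} (h : ∀ x, R ≤ ‖x‖ → f x = 0) :
    HasCompactSupport f :=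
  HasCompactSupport.intro (isCompact_closedBall (0 : EuclideanSpace ℝ (Fin 2)) R) fun x hx =>
    h x (le_of_lt (by simpa [mem_closedBall, dist_zero_right] using hx))

/-- `(∫ g∘circlePt)² ≤ 2π ∫ (g∘circlePt)²` (Jensen on the circle). [folklore] -/
theorem sq_circSum_le {g : EuclideanSpace ℝ (Fin 2) → ℝ} (hg : Continuous g) (r : ℝ) :
    (∫ θ in (-π)..π, g (circlePt r θ)) ^ 2 ≤ 2 * π * ∫ θ in (-π)..π, g (circlePt r θ) ^ 2 := by
  have h := two_pi_mul_circleMean_sq_le hg r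
  have hπ : 0 < 2 * π := by linarith [Real.pi_pos]
  have e : (∫ θ in (-π)..π, g (circlePt r θ)) ^ 2 = 2 * π * (2 * π * ((2 * π)⁻¹ * ∫ t in (-π)..π, g (circlePt r t)) ^ 2) := by
    field_simp
  rw [e]
  exact mul_le_mul_of_nonneg_left h hπ.le

/-- `∫_{-π}^{π} cos 2θ dθ = 0`. [folklore] -/
theorem integral_cos_two_mul : ∫ θ in (-π)..π, Real.cos (2 * θ) = 0 := by
  have hd : ∀ t : ℝ, HasDerivAt (fun t : ℝ => Real.sin (2 * t) / 2) (Real.cos (2 * t)) t := fun t => by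
    have h := (((hasDerivAt_id t).const_mul 2).sin).div_const 2
    simp only [id, mul_one] at h
    exact h.congr_deriv (by ring)
  rw [intervalIntegral.integral_eq_sub_of_hasDerivAt (fun t _ => hd t)
    ((Real.continuous_cos.comp (continuous_const.mul continuous_id)).intervalIntegrable _ _)]
  have h1 : Real.sin (2 * π) = 0 := Real.sin_two_pi
  have h2 : Real.sin (2 * -π) = 0 := by rw [mul_neg, Real.sin_neg, Real.sin_two_pi, neg_zero]
  rw [h1, h2]; simp

section Assembly

variable {w : EuclideanSpace ℝ (Fin 2) → ℝ}

/-- The circular mean `x ↦ (2π)⁻¹ M₀(|x|)` is continuous. [folklore] -/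
theorem continuous_circMean_norm (hw : Continuous w) : Continuous fun x : EuclideanSpace ℝ (Fin 2) => ((2 * π)⁻¹ * ∫ t in (-π)..π, w (circlePt ‖x‖ t)) :=
  continuous_const.mul ((continuous_circSum' hw).comp continuous_norm)

/-- The deviation `w − (2π)⁻¹M₀(|x|)` vanishes where `w` does (radially). [folklore] -/
theorem deviation_eq_zero {R : ℝ} (h0 : ∀ y, R ≤ ‖y‖ → w y = 0) (x : EuclideanSpace ℝ (Fin 2)) (hx : R ≤ ‖x‖) :
    w x - ((2 * π)⁻¹ * ∫ t in (-π)..π, w (circlePt ‖x‖ t)) = 0 := by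
  have h1 : ∀ t : ℝ, w (circlePt ‖x‖ t) = 0 := fun t => h0 _ (by rw [norm_circlePt, abs_norm]; exact hx)
  simp [h0 x hx, h1]

/-- Continuity of the Gaussian weight `p = e^{a|x|²/4}`. [folklore] -/
theorem continuous_gaussWeightP (lam : ℝ) : Continuous fun x : EuclideanSpace ℝ (Fin 2) => Real.exp ((1 - lam) / 4 * ‖x‖ ^ 2) :=
  Real.continuous_exp.comp (continuous_const.mul (continuous_norm.pow 2))

/-- **Far part (Pythagoras on circles)**: `∫ p|x|² (w − m̄)² ≤ ∫ p|x|² w²`. [folklore] -/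
theorem integral_gaussWeight_normSq_deviation_le (hw : ContDiff ℝ 2 w) (hwc : HasCompactSupport w) (lam : ℝ) :
    ∫ x, Real.exp ((1 - lam) / 4 * ‖x‖ ^ 2) * (‖x‖ ^ 2 * (w x - ((2 * π)⁻¹ * ∫ t in (-π)..π, w (circlePt ‖x‖ t))) ^ 2) ≤ ∫ x, Real.exp ((1 - lam) / 4 * ‖x‖ ^ 2) * (‖x‖ ^ 2 * w x ^ 2) := by
  obtain ⟨R, hR1, h0, -⟩ := exists_radius_one_le hwc
  have hpc := continuous_gaussWeightP lam
  have hdc : Continuous fun x : EuclideanSpace ℝ (Fin 2) => w x - ((2 * π)⁻¹ * ∫ t in (-π)..π, w (circlePt ‖x‖ t)) := hw.continuous.sub (continuous_circMean_norm hw.continuous)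
  have hc1 : Continuous fun x : EuclideanSpace ℝ (Fin 2) => Real.exp ((1 - lam) / 4 * ‖x‖ ^ 2) * (‖x‖ ^ 2 * (w x - ((2 * π)⁻¹ * ∫ t in (-π)..π, w (circlePt ‖x‖ t))) ^ 2) :=
    hpc.mul ((continuous_norm.pow 2).mul (hdc.pow 2))
  have hc2 : Continuous fun x : EuclideanSpace ℝ (Fin 2) => Real.exp ((1 - lam) / 4 * ‖x‖ ^ 2) * (‖x‖ ^ 2 * w x ^ 2) :=
    hpc.mul ((continuous_norm.pow 2).mul (hw.continuous.pow 2))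
  have hi1 : Integrable fun x : EuclideanSpace ℝ (Fin 2) => Real.exp ((1 - lam) / 4 * ‖x‖ ^ 2) * (‖x‖ ^ 2 * (w x - ((2 * π)⁻¹ * ∫ t in (-π)..π, w (circlePt ‖x‖ t))) ^ 2) :=
    hc1.integrable_of_hasCompactSupport (hasCompactSupport_of_norm_le (R := R) fun x hx => by
      simp only [deviation_eq_zero h0 x hx]; simp)
  have hi2 : Integrable fun x : EuclideanSpace ℝ (Fin 2) => Real.exp ((1 - lam) / 4 * ‖x‖ ^ 2) * (‖x‖ ^ 2 * w x ^ 2) :=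
    hc2.integrable_of_hasCompactSupport (hasCompactSupport_of_norm_le (R := R) fun x hx => by simp [h0 x hx])
  rw [integral_eq_setIntegral_mul_circSum hi1, integral_eq_setIntegral_mul_circSum hi2]
  refine setIntegral_mono_on (integrableOn_mul_circSum hi1) (integrableOn_mul_circSum hi2) measurableSet_Ioi
    fun r hr => ?_
  have hr : 0 < r := hr
  simp_rw [norm_circlePt, abs_of_pos hr]
  have e1 : ∫ θ in (-π)..π, Real.exp ((1 - lam) / 4 * r ^ 2) * (r ^ 2 * (w (circlePt r θ) - (2 * π)⁻¹ * ∫ t in (-π)..π, w (circlePt r t)) ^ 2) =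
      Real.exp ((1 - lam) / 4 * r ^ 2) * r ^ 2 * ∫ θ in (-π)..π, (w (circlePt r θ) - (2 * π)⁻¹ * ∫ t in (-π)..π, w (circlePt r t)) ^ 2 := by
    calc _ = ∫ θ in (-π)..π, (Real.exp ((1 - lam) / 4 * r ^ 2) * r ^ 2) *
          (w (circlePt r θ) - (2 * π)⁻¹ * ∫ t in (-π)..π, w (circlePt r t)) ^ 2 :=
          intervalIntegral.integral_congr fun θ _ => by ring
      _ = _ := intervalIntegral.integral_const_mul _ _
  have e2 : ∫ θ in (-π)..π, Real.exp ((1 - lam) / 4 * r ^ 2) * (r ^ 2 * w (circlePt r θ) ^ 2) =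
      Real.exp ((1 - lam) / 4 * r ^ 2) * r ^ 2 * ∫ θ in (-π)..π, w (circlePt r θ) ^ 2 := by
    calc _ = ∫ θ in (-π)..π, (Real.exp ((1 - lam) / 4 * r ^ 2) * r ^ 2) * w (circlePt r θ) ^ 2 :=
          intervalIntegral.integral_congr fun θ _ => by ring
      _ = _ := intervalIntegral.integral_const_mul _ _
  rw [e1, e2, integral_sq_comp_circlePt_eq hw.continuous r]
  have h3 : 0 ≤ 2 * π * ((2 * π)⁻¹ * ∫ t in (-π)..π, w (circlePt r t)) ^ 2 := by positivity
  have h4 : 0 ≤ r * (Real.exp ((1 - lam) / 4 * r ^ 2) * r ^ 2) := by positivity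
  nlinarith [h3, h4]

/-- The radial weight `ρ(r) = p(r)χ(r)Ω(r)` is continuous and positive. [folklore] -/
theorem continuous_gaussWeightChi_omega_radial (lam : ℝ) :
    Continuous (fun r : ℝ => (Real.exp ((1 - lam) / 4 * r ^ 2) * (1 + r ^ 2)⁻¹) *
      ((4 * π)⁻¹ * Real.exp (-(r ^ 2 / 4)) / (2 * kerWeight r))) ∧
    ∀ r : ℝ, 0 < (Real.exp ((1 - lam) / 4 * r ^ 2) * (1 + r ^ 2)⁻¹) * ((4 * π)⁻¹ * Real.exp (-(r ^ 2 / 4)) / (2 * kerWeight r)) := by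
  refine ⟨((Real.continuous_exp.comp (continuous_const.mul (continuous_pow 2))).mul
      ((continuous_const.add (continuous_pow 2)).inv₀ fun r => (by positivity : (0:ℝ) < 1 + r ^ 2).ne')).mul
      ((continuous_const.mul (Real.continuous_exp.comp ((continuous_pow 2).div_const 4).neg)).div
        (continuous_const.mul continuous_kerWeight) fun r => (mul_pos two_pos (kerWeight_pos r)).ne'), fun r => ?_⟩
  have := kerWeight_pos r
  positivity

/-- **Near part (Wirtinger on circles)**: `∫ pχΩ (w − m̄)² ≤ ∫ pχΩ (∂_θw)²`. [folklore] -/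
theorem integral_gaussWeightChi_omega_deviation_le (hw : ContDiff ℝ 2 w) (hwc : HasCompactSupport w) (lam : ℝ) :
    ∫ x, ((Real.exp ((1 - lam) / 4 * ‖x‖ ^ 2) * (1 + ‖x‖ ^ 2)⁻¹) * (gaussVortexProfile x / (2 * kerWeight ‖x‖))) * (w x - ((2 * π)⁻¹ * ∫ t in (-π)..π, w (circlePt ‖x‖ t))) ^ 2 ≤ ∫ x, ((Real.exp ((1 - lam) / 4 * ‖x‖ ^ 2) * (1 + ‖x‖ ^ 2)⁻¹) * (gaussVortexProfile x / (2 * kerWeight ‖x‖))) * (fderiv ℝ w x (perp x)) ^ 2 := by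
  obtain ⟨R, hR1, h0, h1⟩ := exists_radius_one_le hwc
  have hw1 : ContDiff ℝ 1 w := hw.of_le one_le_two
  obtain ⟨hρc, hρ0⟩ := continuous_gaussWeightChi_omega_radial lam
  have hdc : Continuous fun x : EuclideanSpace ℝ (Fin 2) => w x - ((2 * π)⁻¹ * ∫ t in (-π)..π, w (circlePt ‖x‖ t)) := hw.continuous.sub (continuous_circMean_norm hw.continuous)
  have hi1 : Integrable fun x : EuclideanSpace ℝ (Fin 2) => (Real.exp ((1 - lam) / 4 * ‖x‖ ^ 2) * (1 + ‖x‖ ^ 2)⁻¹) *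
      ((4 * π)⁻¹ * Real.exp (-(‖x‖ ^ 2 / 4)) / (2 * kerWeight ‖x‖)) * (w x - ((2 * π)⁻¹ * ∫ t in (-π)..π, w (circlePt ‖x‖ t))) ^ 2 := by
    have hc : Continuous fun x : EuclideanSpace ℝ (Fin 2) => (Real.exp ((1 - lam) / 4 * ‖x‖ ^ 2) * (1 + ‖x‖ ^ 2)⁻¹) *
        ((4 * π)⁻¹ * Real.exp (-(‖x‖ ^ 2 / 4)) / (2 * kerWeight ‖x‖)) * (w x - ((2 * π)⁻¹ * ∫ t in (-π)..π, w (circlePt ‖x‖ t))) ^ 2 :=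
      (hρc.comp continuous_norm).mul (hdc.pow 2)
    exact hc.integrable_of_hasCompactSupport (hasCompactSupport_of_norm_le (R := R) fun x hx => by
      simp only [deviation_eq_zero h0 x hx]; simp)
  have hi2 : Integrable fun x : EuclideanSpace ℝ (Fin 2) => (Real.exp ((1 - lam) / 4 * ‖x‖ ^ 2) * (1 + ‖x‖ ^ 2)⁻¹) *
      ((4 * π)⁻¹ * Real.exp (-(‖x‖ ^ 2 / 4)) / (2 * kerWeight ‖x‖)) * (fderiv ℝ w x (perp x)) ^ 2 := by
    have hc : Continuous fun x : EuclideanSpace ℝ (Fin 2) => (Real.exp ((1 - lam) / 4 * ‖x‖ ^ 2) * (1 + ‖x‖ ^ 2)⁻¹) *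
        ((4 * π)⁻¹ * Real.exp (-(‖x‖ ^ 2 / 4)) / (2 * kerWeight ‖x‖)) * (fderiv ℝ w x (perp x)) ^ 2 :=
      (hρc.comp continuous_norm).mul ((contDiff_one_angular hw).continuous.pow 2)
    exact hc.integrable_of_hasCompactSupport (hasCompactSupport_of_norm_le (R := R) fun x hx => by simp [h1 _ x hx])
  exact planar_wirtinger_mean hw1 (fun r hr => (hρ0 r).le) hi1 hi2

/-- **Pythagoras**: `N_w = ∫ p(w − m̄)² + (2π)⁻¹ ∫_0^R p r M₀²` for `R ≥ 0` beyond the support. [folklore] -/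
theorem integral_gaussWeight_sq_eq_deviation_add (hw : ContDiff ℝ 2 w) {R : ℝ} (hR : 0 ≤ R)
    (h0 : ∀ y, R ≤ ‖y‖ → w y = 0) (lam : ℝ) :
    ∫ x, Real.exp ((1 - lam) / 4 * ‖x‖ ^ 2) * w x ^ 2 = (∫ x, Real.exp ((1 - lam) / 4 * ‖x‖ ^ 2) * (w x - ((2 * π)⁻¹ * ∫ t in (-π)..π, w (circlePt ‖x‖ t))) ^ 2) +
      (2 * π)⁻¹ * ∫ r in (0:ℝ)..R, Real.exp ((1 - lam) / 4 * r ^ 2) * r * (∫ θ in (-π)..π, w (circlePt r θ)) ^ 2 := by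
  have hpc := continuous_gaussWeightP lam
  have hdc : Continuous fun x : EuclideanSpace ℝ (Fin 2) => w x - ((2 * π)⁻¹ * ∫ t in (-π)..π, w (circlePt ‖x‖ t)) := hw.continuous.sub (continuous_circMean_norm hw.continuous)
  have hcN : Continuous fun x : EuclideanSpace ℝ (Fin 2) => Real.exp ((1 - lam) / 4 * ‖x‖ ^ 2) * w x ^ 2 := hpc.mul (hw.continuous.pow 2)
  have hcD : Continuous fun x : EuclideanSpace ℝ (Fin 2) => Real.exp ((1 - lam) / 4 * ‖x‖ ^ 2) * (w x - ((2 * π)⁻¹ * ∫ t in (-π)..π, w (circlePt ‖x‖ t))) ^ 2 := hpc.mul (hdc.pow 2)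
  have hiN : Integrable fun x : EuclideanSpace ℝ (Fin 2) => Real.exp ((1 - lam) / 4 * ‖x‖ ^ 2) * w x ^ 2 :=
    hcN.integrable_of_hasCompactSupport (hasCompactSupport_of_norm_le (R := R) fun x hx => by simp [h0 x hx])
  have hiD : Integrable fun x : EuclideanSpace ℝ (Fin 2) => Real.exp ((1 - lam) / 4 * ‖x‖ ^ 2) * (w x - ((2 * π)⁻¹ * ∫ t in (-π)..π, w (circlePt ‖x‖ t))) ^ 2 :=
    hcD.integrable_of_hasCompactSupport (hasCompactSupport_of_norm_le (R := R) fun x hx => by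
      simp only [deviation_eq_zero h0 x hx]; simp)
  have hM0c : Continuous fun r : ℝ => (∫ θ in (-π)..π, w (circlePt r θ)) := continuous_circSum' hw.continuous
  have hhc : Continuous fun r : ℝ => (2 * π)⁻¹ * (Real.exp ((1 - lam) / 4 * r ^ 2) * r * (∫ θ in (-π)..π, w (circlePt r θ)) ^ 2) :=
    continuous_const.mul (((Real.continuous_exp.comp (continuous_const.mul (continuous_pow 2))).mul continuous_id).mul
      (hM0c.pow 2))
  have hM0z : ∀ r, R < r → (∫ θ in (-π)..π, w (circlePt r θ)) = 0 := fun r hr => by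
    have hn : ∀ θ : ℝ, R ≤ ‖circlePt r θ‖ := fun θ => by
      rw [norm_circlePt]; exact hr.le.trans (le_abs_self r)
    simp [h0 _ (hn _)]
  have hhz : ∀ r, R < r → (2 * π)⁻¹ * (Real.exp ((1 - lam) / 4 * r ^ 2) * r * (∫ θ in (-π)..π, w (circlePt r θ)) ^ 2) = 0 := fun r hr => by
    rw [hM0z r hr]; simp
  have hhi : IntegrableOn (fun r : ℝ => (2 * π)⁻¹ * (Real.exp ((1 - lam) / 4 * r ^ 2) * r * (∫ θ in (-π)..π, w (circlePt r θ)) ^ 2)) (Ioi 0) :=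
    integrableOn_Ioi_of_vanishing hhc hR hhz
  rw [integral_eq_setIntegral_mul_circSum hiN, integral_eq_setIntegral_mul_circSum hiD,
    ← intervalIntegral.integral_const_mul, ← setIntegral_Ioi_eq_intervalIntegral_of_vanishing hhc hR hhz,
    ← integral_add (integrableOn_mul_circSum hiD) hhi]
  refine setIntegral_congr_fun measurableSet_Ioi fun r hr => ?_
  have hr : 0 < r := hr
  simp_rw [norm_circlePt, abs_of_pos hr]
  rw [intervalIntegral.integral_const_mul, intervalIntegral.integral_const_mul, integral_sq_comp_circlePt_eq hw.continuous r]
  have hπ : (2 * π) * (2 * π)⁻¹ = 1 := mul_inv_cancel₀ (by positivity)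
  linear_combination (r * Real.exp ((1 - lam) / 4 * r ^ 2) * (2 * π)⁻¹ * (∫ t in (-π)..π, w (circlePt r t)) ^ 2) * hπ

/-- **Radial integrals against planar ones.** If `H(r)² ≤ 2π ∫ g(circlePt r θ)² dθ` for `r > 0`,
then `∫_0^R p r H² ≤ 2π ∫ p g²`. [folklore] -/
theorem radial_sq_le_two_pi_integral (lam : ℝ) {g : EuclideanSpace ℝ (Fin 2) → ℝ} (hg : Continuous g)
    (hgi : Integrable fun x => Real.exp ((1 - lam) / 4 * ‖x‖ ^ 2) * g x ^ 2) {H : ℝ → ℝ} (hH : Continuous H)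
    (hle : ∀ r, 0 < r → H r ^ 2 ≤ 2 * π * ∫ θ in (-π)..π, g (circlePt r θ) ^ 2) {R : ℝ} (hR : 0 ≤ R) :
    ∫ r in (0:ℝ)..R, Real.exp ((1 - lam) / 4 * r ^ 2) * r * H r ^ 2 ≤ 2 * π * ∫ x, Real.exp ((1 - lam) / 4 * ‖x‖ ^ 2) * g x ^ 2 := by
  rw [integral_eq_setIntegral_mul_circSum hgi]
  have hN : IntegrableOn (fun r : ℝ => r * ∫ θ in (-π)..π, Real.exp ((1 - lam) / 4 * ‖(circlePt r θ)‖ ^ 2) * g (circlePt r θ) ^ 2) (Ioi 0) :=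
    integrableOn_mul_circSum hgi
  have hpg : Continuous fun x : EuclideanSpace ℝ (Fin 2) => Real.exp ((1 - lam) / 4 * ‖x‖ ^ 2) * g x ^ 2 := (continuous_gaussWeightP lam).mul (hg.pow 2)
  have hNc : Continuous fun r : ℝ => r * ∫ θ in (-π)..π, Real.exp ((1 - lam) / 4 * ‖(circlePt r θ)‖ ^ 2) * g (circlePt r θ) ^ 2 :=
    continuous_id.mul (continuous_circSum' hpg)
  have hNc2 : Continuous fun r : ℝ => 2 * π * (r * ∫ θ in (-π)..π, Real.exp ((1 - lam) / 4 * ‖(circlePt r θ)‖ ^ 2) * g (circlePt r θ) ^ 2) :=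
    continuous_const.mul hNc
  have hLc : Continuous fun r : ℝ => Real.exp ((1 - lam) / 4 * r ^ 2) * r * H r ^ 2 :=
    ((Real.continuous_exp.comp (continuous_const.mul (continuous_pow 2))).mul continuous_id).mul (hH.pow 2)
  -- step 1: on `[0, R]`
  have h1 : ∫ r in (0:ℝ)..R, Real.exp ((1 - lam) / 4 * r ^ 2) * r * H r ^ 2 ≤
      ∫ r in (0:ℝ)..R, 2 * π * (r * ∫ θ in (-π)..π, Real.exp ((1 - lam) / 4 * ‖(circlePt r θ)‖ ^ 2) * g (circlePt r θ) ^ 2) := by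
    refine intervalIntegral.integral_mono_on hR (hLc.intervalIntegrable _ _) (hNc2.intervalIntegrable _ _)
      fun r hr => ?_
    rcases hr.1.eq_or_lt with h | h
    · rw [← h]; simp
    · simp_rw [norm_circlePt, abs_of_pos h]
      rw [intervalIntegral.integral_const_mul]
      have := hle r h
      have h0 : 0 ≤ Real.exp ((1 - lam) / 4 * r ^ 2) * r := by positivity
      nlinarith
  -- step 2: extend to `(0, ∞)`
  have h2 : ∫ r in (0:ℝ)..R, 2 * π * (r * ∫ θ in (-π)..π, Real.exp ((1 - lam) / 4 * ‖(circlePt r θ)‖ ^ 2) * g (circlePt r θ) ^ 2) ≤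
      2 * π * ∫ r in Ioi (0:ℝ), r * ∫ θ in (-π)..π, Real.exp ((1 - lam) / 4 * ‖(circlePt r θ)‖ ^ 2) * g (circlePt r θ) ^ 2 := by
    rw [intervalIntegral.integral_const_mul, intervalIntegral.integral_of_le hR]
    refine mul_le_mul_of_nonneg_left (setIntegral_mono_set hN ?_ (ae_of_all _ fun r hr => Ioc_subset_Ioi_self hr))
      (by linarith [Real.pi_pos])
    rw [EventuallyLE, ae_restrict_iff' measurableSet_Ioi]
    refine Eventually.of_forall fun r hr => ?_
    have hr : 0 < r := hr
    exact mul_nonneg hr.le (intervalIntegral.integral_nonneg (by linarith [Real.pi_pos]) fun θ _ => by positivity)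
  exact h1.trans h2

/-- **`N_F̄ ≤ 2π N_f`** for the circular sums of a continuous `g` with `p g² ∈ L¹`. [folklore] -/
theorem radial_circSum_sq_le (lam : ℝ) {g : EuclideanSpace ℝ (Fin 2) → ℝ} (hg : Continuous g)
    (hgi : Integrable fun x => Real.exp ((1 - lam) / 4 * ‖x‖ ^ 2) * g x ^ 2) {R : ℝ} (hR : 0 ≤ R) :
    ∫ r in (0:ℝ)..R, Real.exp ((1 - lam) / 4 * r ^ 2) * r * (∫ θ in (-π)..π, g (circlePt r θ)) ^ 2 ≤
      2 * π * ∫ x, Real.exp ((1 - lam) / 4 * ‖x‖ ^ 2) * g x ^ 2 :=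
  radial_sq_le_two_pi_integral lam hg hgi (continuous_circSum' hg) (fun r _ => sq_circSum_le hg r) hR

/-- **`N_𝒜 ≤ 2π ∫ p (w − m̄)²`**: the `cos 2θ`-moment only sees the deviation from the mean. [folklore] -/
theorem radial_circCos_sq_le (hw : ContDiff ℝ 2 w) (hwc : HasCompactSupport w) (lam : ℝ) {R : ℝ} (hR : 0 ≤ R) :
    ∫ r in (0:ℝ)..R, Real.exp ((1 - lam) / 4 * r ^ 2) * r * (∫ θ in (-π)..π, Real.cos (2 * θ) * w (circlePt r θ)) ^ 2 ≤
      2 * π * ∫ x, Real.exp ((1 - lam) / 4 * ‖x‖ ^ 2) * (w x - ((2 * π)⁻¹ * ∫ t in (-π)..π, w (circlePt ‖x‖ t))) ^ 2 := by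
  obtain ⟨R', hR1, h0, -⟩ := exists_radius_one_le hwc
  have hpc := continuous_gaussWeightP lam
  have hdc : Continuous fun x : EuclideanSpace ℝ (Fin 2) => w x - ((2 * π)⁻¹ * ∫ t in (-π)..π, w (circlePt ‖x‖ t)) := hw.continuous.sub (continuous_circMean_norm hw.continuous)
  have hcD : Continuous fun x : EuclideanSpace ℝ (Fin 2) => Real.exp ((1 - lam) / 4 * ‖x‖ ^ 2) * (w x - ((2 * π)⁻¹ * ∫ t in (-π)..π, w (circlePt ‖x‖ t))) ^ 2 := hpc.mul (hdc.pow 2)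
  have hiD : Integrable fun x : EuclideanSpace ℝ (Fin 2) => Real.exp ((1 - lam) / 4 * ‖x‖ ^ 2) * (w x - ((2 * π)⁻¹ * ∫ t in (-π)..π, w (circlePt ‖x‖ t))) ^ 2 :=
    hcD.integrable_of_hasCompactSupport (hasCompactSupport_of_norm_le (R := R') fun x hx => by
      simp only [deviation_eq_zero h0 x hx]; simp)
  have hAc : Continuous fun r : ℝ => (∫ θ in (-π)..π, Real.cos (2 * θ) * w (circlePt r θ)) :=
    continuous_circSum hw.continuous (Real.continuous_cos.comp (continuous_const.mul continuous_id))
  refine radial_sq_le_two_pi_integral lam hdc hiD hAc (fun r hr => ?_) hR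
  -- `𝒜(r) = ∫ cos 2θ (w − m̄)`, `|𝒜(r)| ≤ ∫ |w − m̄|`, Jensen
  have hwc' : Continuous fun θ : ℝ => w (circlePt r θ) := hw.continuous.comp (continuous_circlePt r)
  have hcos : Continuous fun θ : ℝ => Real.cos (2 * θ) := Real.continuous_cos.comp (continuous_const.mul continuous_id)
  simp_rw [norm_circlePt, abs_of_pos hr]
  have i1 : IntervalIntegrable (fun θ : ℝ => Real.cos (2 * θ) * w (circlePt r θ)) volume (-π) π :=
    (hcos.mul hwc').intervalIntegrable _ _
  have i2 : IntervalIntegrable (fun θ : ℝ => Real.cos (2 * θ) * ((2 * π)⁻¹ * ∫ t in (-π)..π, w (circlePt r t))) volume (-π) π :=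
    (hcos.mul continuous_const).intervalIntegrable _ _
  have e1 : (∫ θ in (-π)..π, Real.cos (2 * θ) * w (circlePt r θ)) = ∫ θ in (-π)..π, Real.cos (2 * θ) * (w (circlePt r θ) - (2 * π)⁻¹ * ∫ t in (-π)..π, w (circlePt r t)) := by
    have h2 : ∫ θ in (-π)..π, Real.cos (2 * θ) * ((2 * π)⁻¹ * ∫ t in (-π)..π, w (circlePt r t)) = 0 := by
      rw [intervalIntegral.integral_mul_const, integral_cos_two_mul, zero_mul]
    rw [← sub_zero (∫ θ in (-π)..π, Real.cos (2 * θ) * w (circlePt r θ)), ← h2, ← intervalIntegral.integral_sub i1 i2]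
    exact intervalIntegral.integral_congr fun θ _ => by ring
  have i3 : IntervalIntegrable (fun θ : ℝ => |Real.cos (2 * θ) * (w (circlePt r θ) - (2 * π)⁻¹ * ∫ t in (-π)..π, w (circlePt r t))|)
      volume (-π) π := (hcos.mul (hwc'.sub continuous_const)).abs.intervalIntegrable _ _
  have i4 : IntervalIntegrable (fun θ : ℝ => |w (circlePt r θ) - (2 * π)⁻¹ * ∫ t in (-π)..π, w (circlePt r t)|)
      volume (-π) π := (hwc'.sub continuous_const).abs.intervalIntegrable _ _
  have habs : |(∫ θ in (-π)..π, Real.cos (2 * θ) * w (circlePt r θ))| ≤ ∫ θ in (-π)..π, |w (circlePt r θ) - (2 * π)⁻¹ * ∫ t in (-π)..π, w (circlePt r t)| := by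
    rw [e1]
    refine (intervalIntegral.abs_integral_le_integral_abs (by linarith [Real.pi_pos])).trans
      (intervalIntegral.integral_mono_on (by linarith [Real.pi_pos]) i3 i4 fun θ _ => ?_)
    rw [abs_mul]
    exact mul_le_of_le_one_left (abs_nonneg _) (Real.abs_cos_le_one _)
  have hJ := sq_circSum_le (hdc.abs) r
  simp_rw [norm_circlePt, abs_of_pos hr, sq_abs] at hJ
  calc (∫ θ in (-π)..π, Real.cos (2 * θ) * w (circlePt r θ)) ^ 2 ≤ (∫ θ in (-π)..π, |w (circlePt r θ) - (2 * π)⁻¹ * ∫ t in (-π)..π, w (circlePt r t)|) ^ 2 := by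
        rw [← sq_abs ((∫ θ in (-π)..π, Real.cos (2 * θ) * w (circlePt r θ)))]
        exact pow_le_pow_left₀ (abs_nonneg _) habs 2
    _ ≤ _ := hJ

/-- Integrability of the deviation terms (continuous, compactly supported). [folklore] -/
theorem integrable_deviation_terms (hw : ContDiff ℝ 2 w) (hwc : HasCompactSupport w) (lam : ℝ) :
    Integrable (fun x : EuclideanSpace ℝ (Fin 2) => Real.exp ((1 - lam) / 4 * ‖x‖ ^ 2) * (w x - ((2 * π)⁻¹ * ∫ t in (-π)..π, w (circlePt ‖x‖ t))) ^ 2) ∧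
    Integrable (fun x : EuclideanSpace ℝ (Fin 2) => ((Real.exp ((1 - lam) / 4 * ‖x‖ ^ 2) * (1 + ‖x‖ ^ 2)⁻¹) * (gaussVortexProfile x / (2 * kerWeight ‖x‖))) * (w x - ((2 * π)⁻¹ * ∫ t in (-π)..π, w (circlePt ‖x‖ t))) ^ 2) ∧
    Integrable (fun x : EuclideanSpace ℝ (Fin 2) => Real.exp ((1 - lam) / 4 * ‖x‖ ^ 2) * (‖x‖ ^ 2 * (w x - ((2 * π)⁻¹ * ∫ t in (-π)..π, w (circlePt ‖x‖ t))) ^ 2)) := by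
  obtain ⟨R, hR1, h0, -⟩ := exists_radius_one_le hwc
  have hpc := continuous_gaussWeightP lam
  obtain ⟨hρc, -⟩ := continuous_gaussWeightChi_omega_radial lam
  have hdc : Continuous fun x : EuclideanSpace ℝ (Fin 2) => w x - ((2 * π)⁻¹ * ∫ t in (-π)..π, w (circlePt ‖x‖ t)) := hw.continuous.sub (continuous_circMean_norm hw.continuous)
  have hsupp : ∀ (φ : EuclideanSpace ℝ (Fin 2) → ℝ), HasCompactSupport fun x => φ x * (w x - ((2 * π)⁻¹ * ∫ t in (-π)..π, w (circlePt ‖x‖ t))) ^ 2 := fun φ =>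
    hasCompactSupport_of_norm_le (R := R) fun x hx => by simp only [deviation_eq_zero h0 x hx]; simp
  have hsupp' : HasCompactSupport fun x : EuclideanSpace ℝ (Fin 2) => Real.exp ((1 - lam) / 4 * ‖x‖ ^ 2) * (‖x‖ ^ 2 * (w x - ((2 * π)⁻¹ * ∫ t in (-π)..π, w (circlePt ‖x‖ t))) ^ 2) :=
    hasCompactSupport_of_norm_le (R := R) fun x hx => by simp only [deviation_eq_zero h0 x hx]; simp
  have hc1 : Continuous fun x : EuclideanSpace ℝ (Fin 2) => Real.exp ((1 - lam) / 4 * ‖x‖ ^ 2) * (w x - ((2 * π)⁻¹ * ∫ t in (-π)..π, w (circlePt ‖x‖ t))) ^ 2 := hpc.mul (hdc.pow 2)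
  have hc2 : Continuous fun x : EuclideanSpace ℝ (Fin 2) => ((Real.exp ((1 - lam) / 4 * ‖x‖ ^ 2) * (1 + ‖x‖ ^ 2)⁻¹) * (gaussVortexProfile x / (2 * kerWeight ‖x‖))) * (w x - ((2 * π)⁻¹ * ∫ t in (-π)..π, w (circlePt ‖x‖ t))) ^ 2 := by
    have h := (hρc.comp continuous_norm).mul (hdc.pow 2)
    exact h
  have hc3 : Continuous fun x : EuclideanSpace ℝ (Fin 2) => Real.exp ((1 - lam) / 4 * ‖x‖ ^ 2) * (‖x‖ ^ 2 * (w x - ((2 * π)⁻¹ * ∫ t in (-π)..π, w (circlePt ‖x‖ t))) ^ 2) :=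
    hpc.mul ((continuous_norm.pow 2).mul (hdc.pow 2))
  exact ⟨hc1.integrable_of_hasCompactSupport (hsupp _), hc2.integrable_of_hasCompactSupport (hsupp _),
    hc3.integrable_of_hasCompactSupport hsupp'⟩

end Assembly

/-! ### Bookkeeping and the main theorem -/

/-- Scalar bookkeeping for the main theorem. [folklore] -/
private theorem evenSector_bookkeeping {Nw Nf D NM NF NA Tw Tθ Q X2 X2d G a lam α CE CN K M₁ : ℝ}
    (ha0 : 0 < a) (hl : lam ^ 2 ≤ 1) (hNf : 0 ≤ Nf) (hD : 0 ≤ D) (hNM : 0 ≤ NM)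
    (hCE : 0 ≤ CE) (hCN : 0 ≤ CN) (hK : 0 ≤ K) (hM₁ : 0 ≤ M₁) (hG : 0 ≤ G)
    (h1 : Nw = D + (2 * π)⁻¹ * NM) (h2 : NM ≤ 1716 / a ^ 2 * (NF + lam ^ 2 * NA)) (h3 : NF ≤ 2 * π * Nf)
    (h4 : NA ≤ 2 * π * D) (h5 : D ≤ M₁ * Tw + (4 * (1 + 1716 / a ^ 2) * CE + 1)⁻¹ * X2d) (h6 : Tw ≤ Tθ)
    (h7 : Tθ ≤ K * Q) (h8 : |α| * Q ≤ CN * (Nw + Nf)) (h9 : G + X2 ≤ CE * (Nw + Nf)) (h10 : X2d ≤ X2)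
    (hα : 4 * (1 + 1716 / a ^ 2) * M₁ * K * CN + 1 ≤ |α|) :
    Nw ≤ (1 + 3432 / a ^ 2) * Nf := by
  set B : ℝ := 1 + 1716 / a ^ 2 with hB
  have hBa : 0 ≤ 1716 / a ^ 2 := by positivity
  have hB0 : 0 ≤ B := by rw [hB]; positivity
  have hπ : 0 < 2 * π := by linarith [Real.pi_pos]
  have hNw0 : 0 ≤ Nw := by rw [h1]; positivity
  set S : ℝ := Nw + Nf with hS
  have hS0 : 0 ≤ S := add_nonneg hNw0 hNf
  -- the radial part
  have k1 : NM ≤ 1716 / a ^ 2 * (2 * π * Nf + lam ^ 2 * (2 * π * D)) :=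
    h2.trans (mul_le_mul_of_nonneg_left (add_le_add h3 (mul_le_mul_of_nonneg_left h4 (sq_nonneg _))) hBa)
  have k2 : (2 * π)⁻¹ * NM ≤ 1716 / a ^ 2 * (Nf + lam ^ 2 * D) := by
    rw [inv_mul_le_iff₀ hπ]
    refine k1.trans (le_of_eq ?_)
    ring
  have k3 : lam ^ 2 * D ≤ D := by nlinarith
  have k4 : Nw ≤ B * D + 1716 / a ^ 2 * Nf := by
    have := mul_le_mul_of_nonneg_left (add_le_add_left k3 Nf) hBa
    rw [h1, hB]
    linarith
  -- the deviation
  have hα0 : 0 < |α| := lt_of_lt_of_le (by positivity) hα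
  have k5 : Q ≤ CN * S / |α| := by
    rw [le_div_iff₀ hα0]; linarith
  have k6 : Tw ≤ K * (CN * S / |α|) := h6.trans (h7.trans (mul_le_mul_of_nonneg_left k5 hK))
  have k7 : X2d ≤ CE * S := h10.trans (by linarith)
  have hR1 : 0 < 4 * B * CE + 1 := by positivity
  have k8 : D ≤ M₁ * (K * (CN * S / |α|)) + (4 * B * CE + 1)⁻¹ * (CE * S) :=
    h5.trans (add_le_add (mul_le_mul_of_nonneg_left k6 hM₁) (mul_le_mul_of_nonneg_left k7 (inv_pos.2 hR1).le))
  have k9 : B * (M₁ * (K * (CN * S / |α|))) ≤ S / 4 := by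
    have e : B * (M₁ * (K * (CN * S / |α|))) = (B * M₁ * K * CN / |α|) * S := by ring
    have h : B * M₁ * K * CN / |α| ≤ 1 / 4 := by
      rw [div_le_iff₀ hα0]; linarith
    rw [e]
    have := mul_le_mul_of_nonneg_right h hS0
    linarith
  have k10 : B * ((4 * B * CE + 1)⁻¹ * (CE * S)) ≤ S / 4 := by
    have e : B * ((4 * B * CE + 1)⁻¹ * (CE * S)) = (B * CE / (4 * B * CE + 1)) * S := by
      rw [div_eq_mul_inv]; ring
    have h : B * CE / (4 * B * CE + 1) ≤ 1 / 4 := by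
      rw [div_le_iff₀ hR1]; linarith
    rw [e]
    have := mul_le_mul_of_nonneg_right h hS0
    linarith
  have k11 : B * D ≤ S / 4 + S / 4 := by
    have := mul_le_mul_of_nonneg_left k8 hB0
    rw [mul_add] at this
    linarith
  have k12 : Nw ≤ S / 2 + 1716 / a ^ 2 * Nf := by linarith
  rw [hS] at k12
  have e : (1 + 3432 / a ^ 2) * Nf = Nf + 2 * (1716 / a ^ 2 * Nf) := by ring
  rw [e]
  linarith

/-- `G_λ(x)⁻¹ = (4π/(1−λ)) e^{(1−λ)|x|²/4}`. [folklore] -/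
private theorem inv_gaussWeightLam_eq_mul_gaussWeightP {lam : ℝ} (hlam : lam < 1) (x : EuclideanSpace ℝ (Fin 2)) :
    (gaussWeightLam lam x)⁻¹ = 4 * π / (1 - lam) * Real.exp ((1 - lam) / 4 * ‖x‖ ^ 2) := by
  have ha : (1 - lam) ≠ 0 := by linarith
  rw [gaussWeightLam, mul_inv, Real.exp_neg, inv_inv]
  field_simp

/-- **Maekawa 2009, Lemma 4.1 (4.1) — the even-sector inverse bound, proved.** For `λ ∈ [0,1)` there
are `Θ` and `C > 0` with `∫ G_λ⁻¹ w² ≤ C² ∫ G_λ⁻¹ |(L + λM − αΛ)w|²` for all `|α| ≥ Θ` and all even,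
mass-zero `w ∈ C²_c(ℝ²)`. (Quantitative proof; `C² = 1 + 3432/(1−λ)²`.)
[cite: Maekawa2009b, §4 Lemma 4.1 (4.1)] -/
theorem Maekawa2009_evenSectorInverseBound_holds : Maekawa2009_evenSectorInverseBound := by
  intro lam hlam
  obtain ⟨hlam0, hlam1⟩ := hlam
  have ha0 : 0 < 1 - lam := by linarith
  have ha1 : 1 - lam ≤ 1 := by linarith
  obtain ⟨CE, hCE0, hE⟩ := asymBurgers_uniform_energy_bound hlam0 hlam1
  obtain ⟨CN, hCN0, hN⟩ := asymBurgers_angular_smallness hlam0 hlam1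
  obtain ⟨K, hK0, hP⟩ := exists_integral_gaussWeightChi_omega_sq_angular_le hlam0 hlam1
  -- constants
  set B : ℝ := 1 + 1716 / (1 - lam) ^ 2 with hB
  have hB0 : 0 ≤ B := by positivity
  set R₁ : ℝ := Real.sqrt (4 * B * CE + 1) with hR₁
  have hR1sq : R₁ ^ 2 = 4 * B * CE + 1 := Real.sq_sqrt (by positivity)
  have hR₁0 : 0 < R₁ := Real.sqrt_pos.2 (by positivity)
  set M₁ : ℝ := 8 * π * (1 + R₁ ^ 2) * (1 + R₁ ^ 2 / 4) with hM₁
  have hM₁0 : 0 ≤ M₁ := by positivity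
  refine ⟨4 * B * M₁ * K * CN + 1, Real.sqrt (1 + 3432 / (1 - lam) ^ 2), Real.sqrt_pos.2 (by positivity),
    fun α hα w hw hwc heven hmass => ?_⟩
  -- the pieces
  obtain ⟨hiNf, hEw⟩ := hE α w hw hwc
  have hNw := hN α w hw hwc
  have hPw := hP w hw hwc heven hmass
  obtain ⟨R, c, hR1, h0, hM0c, hFc, hAc, hflux, hmassR, hformula⟩ := radialMean_package hw hwc lam α
  have hR0 : 0 ≤ R := by linarith
  have hmass' : ∫ r in (0:ℝ)..R, r * (∫ θ in (-π)..π, w (circlePt r θ)) = 0 := by rw [← hmassR, hmass]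
  have hrad := radialMean_weighted_sq_le (F := fun r => (∫ θ in (-π)..π, (strainedVorticityOperator lam w (circlePt r θ) - α * (⟪gaussVortexVelocity (circlePt r θ), gradient w (circlePt r θ)⟫ + ⟪biotSavart2D w (circlePt r θ), gradient gaussVortexProfile (circlePt r θ)⟫)))) (A := fun r => (∫ θ in (-π)..π, Real.cos (2 * θ) * w (circlePt r θ))) (m := fun r => (∫ θ in (-π)..π, w (circlePt r θ)))
    hFc hAc hM0c ha0 ha1 hR1 hflux hmass' hformula
  have hNF := radial_circSum_sq_le lam (continuous_operator hw hwc lam α) hiNf hR0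
  have hNA := radial_circCos_sq_le hw hwc lam hR0
  have hPyth := integral_gaussWeight_sq_eq_deviation_add hw hR0 h0 lam
  have hTw := integral_gaussWeightChi_omega_deviation_le hw hwc lam
  have hX2d := integral_gaussWeight_normSq_deviation_le hw hwc lam
  obtain ⟨hiD, hiT, hiX⟩ := integrable_deviation_terms hw hwc lam
  -- the split of the deviation
  have hsplit : ∫ x, Real.exp ((1 - lam) / 4 * ‖x‖ ^ 2) * (w x - ((2 * π)⁻¹ * ∫ t in (-π)..π, w (circlePt ‖x‖ t))) ^ 2 ≤
      M₁ * (∫ x, ((Real.exp ((1 - lam) / 4 * ‖x‖ ^ 2) * (1 + ‖x‖ ^ 2)⁻¹) * (gaussVortexProfile x / (2 * kerWeight ‖x‖))) * (w x - ((2 * π)⁻¹ * ∫ t in (-π)..π, w (circlePt ‖x‖ t))) ^ 2) +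
        (4 * (1 + 1716 / (1 - lam) ^ 2) * CE + 1)⁻¹ * ∫ x, Real.exp ((1 - lam) / 4 * ‖x‖ ^ 2) * (‖x‖ ^ 2 * (w x - ((2 * π)⁻¹ * ∫ t in (-π)..π, w (circlePt ‖x‖ t))) ^ 2) := by
    rw [← hB, ← hR1sq, ← integral_const_mul, ← integral_const_mul, ← integral_add (hiT.const_mul _) (hiX.const_mul _)]
    refine integral_mono hiD ((hiT.const_mul _).add (hiX.const_mul _)) fun x => ?_
    have h := gaussWeight_le_split lam hR₁0 x
    have h2 : 0 ≤ (w x - ((2 * π)⁻¹ * ∫ t in (-π)..π, w (circlePt ‖x‖ t))) ^ 2 := sq_nonneg _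
    have h3 := mul_le_mul_of_nonneg_right h h2
    refine h3.trans (le_of_eq ?_)
    ring
  -- nonnegativity
  have hD0 : 0 ≤ ∫ x, Real.exp ((1 - lam) / 4 * ‖x‖ ^ 2) * (w x - ((2 * π)⁻¹ * ∫ t in (-π)..π, w (circlePt ‖x‖ t))) ^ 2 := integral_nonneg fun x => by positivity
  have hNM0 : 0 ≤ ∫ r in (0:ℝ)..R, Real.exp ((1 - lam) / 4 * r ^ 2) * r * (∫ θ in (-π)..π, w (circlePt r θ)) ^ 2 :=
    intervalIntegral.integral_nonneg hR0 fun r hr => by have : 0 ≤ r := hr.1; positivity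
  have hG0 : 0 ≤ ∫ x, Real.exp ((1 - lam) / 4 * ‖x‖ ^ 2) * (fderiv ℝ w x (EuclideanSpace.single 0 1) ^ 2 + fderiv ℝ w x (EuclideanSpace.single 1 1) ^ 2) :=
    integral_nonneg fun x => by positivity
  have hNf0 : 0 ≤ ∫ x, Real.exp ((1 - lam) / 4 * ‖x‖ ^ 2) * (strainedVorticityOperator lam w x - α * (⟪gaussVortexVelocity x, gradient w x⟫ + ⟪biotSavart2D w x, gradient gaussVortexProfile x⟫)) ^ 2 := integral_nonneg fun x => by positivity
  have hl : lam ^ 2 ≤ 1 := by nlinarith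
  have hfinal := evenSector_bookkeeping ha0 hl hNf0 hD0 hNM0 hCE0 hCN0 hK0 hM₁0 hG0 hPyth hrad hNF hNA hsplit hTw hPw hNw
    hEw hX2d hα
  -- conversion to the `G_λ⁻¹` weights
  have hconv : ∀ g : EuclideanSpace ℝ (Fin 2) → ℝ, ∫ x, (gaussWeightLam lam x)⁻¹ * g x ^ 2 =
      4 * π / (1 - lam) * ∫ x, Real.exp ((1 - lam) / 4 * ‖x‖ ^ 2) * g x ^ 2 := fun g => by
    rw [← integral_const_mul]
    exact integral_congr_ae (ae_of_all _ fun x => by simp only [inv_gaussWeightLam_eq_mul_gaussWeightP hlam1]; ring)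
  rw [hconv w, hconv (fun x => (strainedVorticityOperator lam w x - α * (⟪gaussVortexVelocity x, gradient w x⟫ + ⟪biotSavart2D w x, gradient gaussVortexProfile x⟫))), Real.sq_sqrt (by positivity)]
  have hc0 : 0 < 4 * π / (1 - lam) := by positivity
  calc 4 * π / (1 - lam) * ∫ x, Real.exp ((1 - lam) / 4 * ‖x‖ ^ 2) * w x ^ 2 ≤ 4 * π / (1 - lam) * ((1 + 3432 / (1 - lam) ^ 2) * ∫ x, Real.exp ((1 - lam) / 4 * ‖x‖ ^ 2) * (strainedVorticityOperator lam w x - α * (⟪gaussVortexVelocity x, gradient w x⟫ + ⟪biotSavart2D w x, gradient gaussVortexProfile x⟫)) ^ 2) :=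
        mul_le_mul_of_nonneg_left hfinal hc0.le
    _ = _ := by ring

end Literature.Analysis.FluidPDE
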